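import Summits.QuantumAdvantage.QuantumAdvantage.Theorems.CubicForrelationNearExactIsExactTwoModSixPrep

/-!
# Crux `CubicForrelation.NearExactIsExact` (stmt-QuantumAdvantage-14043) — `n = 6r + 2` bits, TWO-SIDED: a type-O cubic never reaches the
  boundary value `1 − 2^{−(2r+1)}` (general `r ≥ 1`)

Certificate seat `b2b-cforr-cert` (gen 6).  HONEST FRAMING: a theorem, uniform in `r`, about cubic Boolean pairs on `6r+2` bits (the type-O
boundary configuration of the uniform one-sided rate `θ_n ≤ 1 − 2^{−⌊n/3⌋−1}`); infinitely many finite-slice verdicts, NOT summit progress.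

`tmo_typeO_lt`: for cubic `f, g : 𝔽₂^{6r+2} → 𝔽₂` (`r ≥ 1`) with `W_g = 2^{2r+1}u` and ALL `u` odd: `Φ(f,g) < 1 − 2^{−(2r+1)}`.  Proof (the `n = 20`
argument with `r` symbolic): the budget `Σ(u − 2^r s)² = 2^{8r+3}(1−Φ) ≤ 2^{6r+2}` pays `≥ 1` at every point, so the residual `τ = u − 2^r s` is
`±1` EVERYWHERE; the general 3- and 4-flat sums (`4 ∣ Σ₃ u`, `8 ∣ Σ₄ u`, Ax for `f`) are the hypotheses (H3)/(H4) of the engine `fl1_flat_l1`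
on the whole space, so `(Σ_y |τ̂(y)|)² ≤ 2^{12r+6}`; but the pairing identity gives `Σ_y (−1)^g τ̂(y) = 2^{8r+2}`, and `2^{16r+4} > 2^{12r+6}`.

References: J. Ax (1964) / R. J. McEliece (1972); MacWilliams–Sloane (1977) Ch. 15 §2; R. O'Donnell (2014) §3.3.  Everything below is proved
from Mathlib and the tree; axioms are the standard three.
-/

set_option linter.dupNamespace false -- D-0017: single-problem summit ⇒ `QuantumAdvantage.QuantumAdvantage` by design

noncomputable section

namespace Summit.QuantumAdvantage.QuantumAdvantage.Theorems.CubicForrelation.NearExactIsExact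

open Finset
open Literature.Computability.QuantumComplexity
open Literature.Computability.QuantumComplexity.BuzetChailloux (bxor zeroVec bxor_bxor_cancel_left bxor_zeroVec zeroVec_bxor bxor_comm
  bxor_self)
open Literature.Computability.QuantumComplexity.DerivativeWalsh (W)

/-- **A type-O cubic on `6r+2` bits never reaches `Φ = 1 − 2^{−(2r+1)}` (`r ≥ 1`).**  For cubic `f, g : 𝔽₂^{(3r+1)+(3r+1)} → 𝔽₂` with
`W_g = 2^{2r+1}u` and every `u(x)` odd: `Φ(f,g) < 1 − (1/2)^{2r+1}`.  Uniform in `r`; NOT summit progress. [this work] -/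
theorem tmo_typeO_lt (r : ℕ) (hr : 1 ≤ r) (f g : (Fin ((3 * r + 1) + (3 * r + 1)) → Bool) → Bool) (hf : IsDegLeFun 3 f)
    (hg : IsDegLeFun 3 g) (u : (Fin ((3 * r + 1) + (3 * r + 1)) → Bool) → ℤ)
    (hu : ∀ x, W (fun y => signOf (g y)) x = (2 : ℝ) ^ (2 * r + 1) * (u x : ℝ)) (hodd : ∀ x, Odd (u x)) :
    forrelation f g < 1 - (1 / 2 : ℝ) ^ (2 * r + 1) := by
  classical
  by_contra hge
  push Not at hge
  obtain ⟨k, rfl⟩ : ∃ k, r = k + 1 := ⟨r - 1, by omega⟩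
  -- budget
  have hbud := tms_budget (k + 1) f g u hu
  have hpow : (2 : ℝ) ^ (8 * (k + 1) + 3) * (1 / 2) ^ (2 * (k + 1) + 1) = 2 ^ (6 * k + 8) := by
    rw [one_div_pow]; field_simp; ring
  have hTle : (∑ x, (u x - 2 ^ (k + 1) * sZ (f x)) ^ 2 : ℤ) ≤ 2 ^ (6 * k + 8) := by
    have h1 : 1 - forrelation f g ≤ (1 / 2 : ℝ) ^ (2 * (k + 1) + 1) := by linarith
    have h' : ((∑ x, (u x - 2 ^ (k + 1) * sZ (f x)) ^ 2 : ℤ) : ℝ) ≤ (2 : ℝ) ^ (6 * k + 8) := by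
      rw [hbud, ← hpow]
      exact mul_le_mul_of_nonneg_left h1 (by positivity)
    exact_mod_cast h'
  -- every point costs at least `1`
  have hτodd : ∀ x, Odd (u x - 2 ^ (k + 1) * sZ (f x)) := by
    intro x
    have h2 : Even ((2 : ℤ) ^ (k + 1) * sZ (f x)) := by rw [pow_succ]; exact ⟨2 ^ k * sZ (f x), by ring⟩
    exact Int.odd_sub.2 (iff_of_true (hodd x) h2)
  have hnonneg : ∀ x, 0 ≤ (u x - 2 ^ (k + 1) * sZ (f x)) ^ 2 - (1 : ℤ) := by
    intro x
    have h0 := Int.odd_iff.1 (hτodd x)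
    have : u x - 2 ^ (k + 1) * sZ (f x) ≤ -1 ∨ 1 ≤ u x - 2 ^ (k + 1) * sZ (f x) := by omega
    have := tp_sq_ge (k := 1) (by norm_num) this
    linarith
  have hcard : (Fintype.card (Fin ((3 * (k + 1) + 1) + (3 * (k + 1) + 1)) → Bool) : ℤ) = 2 ^ (6 * k + 8) := by
    rw [Fintype.card_fun, Fintype.card_bool, Fintype.card_fin]; push_cast; ring
  have hsum0 : ∑ x, ((u x - 2 ^ (k + 1) * sZ (f x)) ^ 2 - (1 : ℤ)) = 0 := by
    refine le_antisymm ?_ (sum_nonneg fun x _ => hnonneg x)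
    rw [sum_sub_distrib, sum_const, card_univ, nsmul_eq_mul, mul_one, hcard]
    linarith
  have hτ : ∀ x, u x - 2 ^ (k + 1) * sZ (f x) = 1 ∨ u x - 2 ^ (k + 1) * sZ (f x) = -1 := by
    intro x
    have h := (sum_eq_zero_iff_of_nonneg fun y _ => hnonneg y).1 hsum0 x (mem_univ x)
    have h1 : (u x - 2 ^ (k + 1) * sZ (f x)) * (u x - 2 ^ (k + 1) * sZ (f x)) = 1 := by rw [← pow_two]; linarith
    exact mul_self_eq_one_iff.1 h1
  -- the budget is spent exactly: `2^{8r+3}(1 − Φ) = 2^{6r+2}`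
  have hTeq : (2 : ℝ) ^ (8 * (k + 1) + 3) * (1 - forrelation f g) = 2 ^ (6 * k + 8) := by
    have hT : (∑ x, (u x - 2 ^ (k + 1) * sZ (f x)) ^ 2 : ℤ) = 2 ^ (6 * k + 8) := by
      have e : ∀ x, (u x - 2 ^ (k + 1) * sZ (f x)) ^ 2 = ((u x - 2 ^ (k + 1) * sZ (f x)) ^ 2 - 1) + 1 := fun x => by ring
      rw [sum_congr rfl fun x _ => e x, sum_add_distrib, hsum0, sum_const, card_univ, nsmul_eq_mul, mul_one, hcard]
      ring
    have h : ((∑ x, (u x - 2 ^ (k + 1) * sZ (f x)) ^ 2 : ℤ) : ℝ) = 2 ^ (6 * k + 8) := by exact_mod_cast hT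
    rw [hbud] at h
    exact h
  -- the engine on the whole space
  set e : (Fin ((3 * (k + 1) + 1) + (3 * (k + 1) + 1)) → Bool) → ℤ := fun x => u x - 2 ^ (k + 1) * sZ (f x) with hedef
  have hS : (univ : Finset (Fin ((3 * (k + 1) + 1) + (3 * (k + 1) + 1)) → Bool)) =
      (univ : Finset (Fin ((3 * (k + 1) + 1) + (3 * (k + 1) + 1)) → Bool)).image (bxor zeroVec) := by
    ext y
    simp only [mem_univ, mem_image, true_and, true_iff]
    exact ⟨y, zeroVec_bxor y⟩
  have H3 : ∀ x ∈ (univ : Finset (Fin ((3 * (k + 1) + 1) + (3 * (k + 1) + 1)) → Bool)),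
      ∀ a b c : Fin ((3 * (k + 1) + 1) + (3 * (k + 1) + 1)) → Bool, a ∈ (univ : Finset _) → b ∈ (univ : Finset _) → c ∈ (univ : Finset _) →
      (4 : ℤ) ∣ ∑ ε : Fin 3 → Bool, e (fun j => x j ^^ decide (Odd #(univ.filter fun i =>
        ε i && (![a, b, c] : Fin 3 → Fin ((3 * (k + 1) + 1) + (3 * (k + 1) + 1)) → Bool) i j))) := by
    intro x _ a b c _ _ _
    have h4 := fs_flat_sum_dvd (e := 2) g u hg hu x ![a, b, c] (by omega)
    obtain ⟨zf, hzf⟩ := sl_sum_sZ_flat f hf x ![a, b, c]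
    have hzf' : ∑ ε : Fin 3 → Bool, 2 ^ (k + 1) * sZ (f (fun j => x j ^^ decide (Odd #(univ.filter fun i =>
          ε i && (![a, b, c] : Fin 3 → Fin ((3 * (k + 1) + 1) + (3 * (k + 1) + 1)) → Bool) i j)))) = 4 * (2 ^ k * zf) := by
      rw [← mul_sum, hzf]; norm_num; ring
    have h4n : (4 : ℤ) ∣ ∑ ε : Fin 3 → Bool, u (fun j => x j ^^ decide (Odd #(univ.filter fun i =>
          ε i && (![a, b, c] : Fin 3 → Fin ((3 * (k + 1) + 1) + (3 * (k + 1) + 1)) → Bool) i j))) := by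
      have e4 : (2 : ℤ) ^ 2 = 4 := by norm_num
      rw [e4] at h4; exact h4
    simp only [e]
    rw [sum_sub_distrib, hzf']
    exact dvd_sub h4n (Dvd.intro _ rfl)
  have H4 : ∀ x ∈ (univ : Finset (Fin ((3 * (k + 1) + 1) + (3 * (k + 1) + 1)) → Bool)),
      ∀ a₀ a₁ a₂ a₃ : Fin ((3 * (k + 1) + 1) + (3 * (k + 1) + 1)) → Bool, a₀ ∈ (univ : Finset _) → a₁ ∈ (univ : Finset _) →
      a₂ ∈ (univ : Finset _) → a₃ ∈ (univ : Finset _) →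
      (8 : ℤ) ∣ ∑ ε : Fin 4 → Bool, e (fun j => x j ^^ decide (Odd #(univ.filter fun i =>
        ε i && (![a₀, a₁, a₂, a₃] : Fin 4 → Fin ((3 * (k + 1) + 1) + (3 * (k + 1) + 1)) → Bool) i j))) := by
    intro x _ a₀ a₁ a₂ a₃ _ _ _ _
    have h8 := fs_flat_sum_dvd (e := 3) g u hg hu x ![a₀, a₁, a₂, a₃] (by omega)
    obtain ⟨zf, hzf⟩ := sl_sum_sZ_flat f hf x ![a₀, a₁, a₂, a₃]
    have hzf' : ∑ ε : Fin 4 → Bool, 2 ^ (k + 1) * sZ (f (fun j => x j ^^ decide (Odd #(univ.filter fun i =>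
          ε i && (![a₀, a₁, a₂, a₃] : Fin 4 → Fin ((3 * (k + 1) + 1) + (3 * (k + 1) + 1)) → Bool) i j)))) = 8 * (2 ^ k * zf) := by
      rw [← mul_sum, hzf]; norm_num; ring
    have h8n : (8 : ℤ) ∣ ∑ ε : Fin 4 → Bool, u (fun j => x j ^^ decide (Odd #(univ.filter fun i =>
          ε i && (![a₀, a₁, a₂, a₃] : Fin 4 → Fin ((3 * (k + 1) + 1) + (3 * (k + 1) + 1)) → Bool) i j))) := by
      have e8 : (2 : ℤ) ^ 3 = 8 := by norm_num
      rw [e8] at h8; exact h8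
    simp only [e]
    rw [sum_sub_distrib, hzf']
    exact dvd_sub h8n (Dvd.intro _ rfl)
  have hE := fl1_flat_l1 univ univ zeroVec (mem_univ _) (fun a _ b _ => mem_univ _) hS e (fun x _ => hτ x) H3 H4
  set A : (Fin ((3 * (k + 1) + 1) + (3 * (k + 1) + 1)) → Bool) → ℝ :=
    fun x => if x ∈ (univ : Finset (Fin ((3 * (k + 1) + 1) + (3 * (k + 1) + 1)) → Bool)) then (e x : ℝ) else 0 with hA
  have hAτ : (fun x => (u x : ℝ) - (2 : ℝ) ^ (k + 1) * signOf (f x)) = A := by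
    funext x
    simp only [A, if_pos (mem_univ x), e]
    push_cast
    rw [tp_sZ_cast]
  have hpair := tms_pairing (k + 1) f g u hu
  rw [hAτ] at hpair
  -- the pairing equals `2^{8r+2}`
  have hP : ∑ y, signOf (g y) * W A y = (2 : ℝ) ^ (8 * k + 10) := by
    rw [hpair, show (2 : ℝ) ^ (10 * (k + 1) + 3) = 2 ^ (2 * k + 2) * 2 ^ (8 * (k + 1) + 3) by ring, mul_assoc, hTeq]
    ring
  have hge' : (2 : ℝ) ^ (8 * k + 10) ≤ ∑ y, |W A y| := by rw [← hP]; exact fl1_pairing_le_l1 g (W A)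
  have hsq : ((2 : ℝ) ^ (8 * k + 10)) ^ 2 ≤ (∑ y, |W A y|) ^ 2 := pow_le_pow_left₀ (by positivity) hge' 2
  have hEn : (∑ y, |W A y|) ^ 2 ≤ (2 : ℝ) ^ (12 * k + 18) := by
    refine hE.trans (le_of_eq ?_)
    rw [show ((3 * (k + 1) + 1) + (3 * (k + 1) + 1)) = 6 * k + 8 by ring]
    ring
  have hbig : (2 : ℝ) ^ (12 * k + 18) < ((2 : ℝ) ^ (8 * k + 10)) ^ 2 := by
    have e2 : ((2 : ℝ) ^ (8 * k + 10)) ^ 2 = 2 ^ (12 * k + 18) * 2 ^ (4 * k + 2) := by ring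
    rw [e2]
    have h1 : (1 : ℝ) < 2 ^ (4 * k + 2) := one_lt_pow₀ (by norm_num) (by omega)
    have h2 : (0 : ℝ) < 2 ^ (12 * k + 18) := by positivity
    exact lt_mul_of_one_lt_right h2 h1
  linarith

end Summit.QuantumAdvantage.QuantumAdvantage.Theorems.CubicForrelation.NearExactIsExact

end
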